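import Summits.NavierStokesRegularity.NavierStokesRegularity.Theorems.SqueezeCycleSingularProfileOfNontrivialMorreySlice
import Literature.Analysis.FluidPDE.PineauVicolPressureIdentification

/-!
# Route SqueezeCycle · item `SingularProfileOfNontrivial` (stmt-NavierStokesRegularity-15368):
# three probe bounds of Tao's pressure-normalisation argument on the MORREY class

Helper file (theorems only). In Tao's probe argument (Tao 2011, proof of Lemma 4.1 (i); the tree's
`NormalisedPressureDischarge` for finite energy, `PineauVicolPressureIdentification` for the decay class)
the gradient of the harmonic part of the pressure is tested against the dilated bump `χ_R(· − x₀)`. This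
file bounds the viscous, transport and boundary probe terms for slices with the scale-invariant Morrey
bound `∫_{B(x,r)} |v|² ≤ A r` (`r ≥ 1`): all are `O((1 + A)/R)` — local energy instead of energy, AM–GM
with the weight `R⁻¹`.

References: T. Tao, Anal. PDE 6 (2013), §4, proof of Lemma 4.1 (i) [Tao2011]; D. Albritton, T. Barker,
J. Math. Fluid Mech. 21 (2019) = arXiv:1811.00502, §1, §3 [AlbrittonBarker2019]; G. Koch, N. Nadirashvili,
G. Seregin, V. Šverák, Acta Math. 203 (2009) [KochNadirashviliSereginSverak2009].
-/

noncomputable section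

-- the sub-problem namespace repeats the summit name (D-0017 layout `Summit.<S>.<P>.Theorems`)
set_option linter.dupNamespace false
-- nested operator types `ℝ³ →L[ℝ] ℝ³ →L[ℝ] ℝ³ →L[ℝ] ℝ` (pressure kernels)
set_option maxSynthPendingDepth 3

namespace Summit.NavierStokesRegularity.NavierStokesRegularity.Theorems.SingularProfile

open MeasureTheory Set Filter Metric Function
open _root_.Topology
open scoped ENNReal NNReal Laplacian ContDiff RealInnerProductSpace
open Literature.Analysis.FluidPDE
open Literature.Analysis.FluidPDE.FourierNS (HasDecay)

/-- **The local energy at scale `R` of a Morrey field**: `∫_{B̄(x₀, Rρ)} |v|² ≤ A R (ρ + 1)` for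
`R ≥ 1`, `ρ ≥ 0` (the closed ball lies in the open ball of radius `R(ρ+1) ≥ 1`). [folklore] -/
theorem integral_closedBall_sq_le_of_morrey
    {v : (EuclideanSpace ℝ (Fin 3)) → (EuclideanSpace ℝ (Fin 3))} (hvc : Continuous v) {A : ℝ}
    (hA : ∀ (x : EuclideanSpace ℝ (Fin 3)) (r : ℝ), 1 ≤ r → ∫ y in ball x r, ‖v y‖ ^ 2 ≤ A * r)
    (x₀ : EuclideanSpace ℝ (Fin 3)) {R ρ : ℝ} (hR : 1 ≤ R) (hρ : 0 ≤ ρ) :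
    ∫ y in closedBall x₀ (R * ρ), ‖v y‖ ^ 2 ≤ A * (R * (ρ + 1)) := by
  have hsub : closedBall x₀ (R * ρ) ⊆ ball x₀ (R * (ρ + 1)) :=
    closedBall_subset_ball (by nlinarith)
  have hint : IntegrableOn (fun y => ‖v y‖ ^ 2) (ball x₀ (R * (ρ + 1))) volume :=
    ((hvc.norm.pow 2).continuousOn.integrableOn_compact (isCompact_closedBall x₀ _)).mono_set
      ball_subset_closedBall
  exact (setIntegral_mono_set hint (ae_of_all _ fun y => sq_nonneg _) (ae_of_all _ hsub)).trans
    (hA x₀ _ (by nlinarith))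

/-- **Weighted `L¹` bound from the LOCAL energy** (AM–GM): if `|g| ≤ c` and `g` vanishes off
`B̄(x₀, ρ)`, then for `s > 0` and continuous `v`,
`∫ |g| |v| ≤ c (s vol B̄(x₀,ρ) + s⁻¹ ∫_{B̄(x₀,ρ)}|v|²)/2` (the finite-energy
`integral_abs_mul_norm_le` applied to the truncated field `1_{B̄} v`). [folklore] -/
theorem integral_abs_mul_norm_le_local {v : (EuclideanSpace ℝ (Fin 3)) → (EuclideanSpace ℝ (Fin 3))}
    (hvc : Continuous v) {g : (EuclideanSpace ℝ (Fin 3)) → ℝ} (hgc : Continuous g) {c s ρ : ℝ}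
    (hc : 0 ≤ c) (hs : 0 < s) (x₀ : EuclideanSpace ℝ (Fin 3)) (hg : ∀ y, |g y| ≤ c)
    (hg0 : ∀ y, ρ < ‖y - x₀‖ → g y = 0) :
    Integrable (fun y => |g y| * ‖v y‖) ∧
    ∫ y, |g y| * ‖v y‖ ≤ c * (s * (volume : Measure (EuclideanSpace ℝ (Fin 3))).real (closedBall x₀ ρ)
      + s⁻¹ * ∫ y in closedBall x₀ ρ, ‖v y‖ ^ 2) / 2 := by
  set B := closedBall x₀ ρ with hB
  set vt : (EuclideanSpace ℝ (Fin 3)) → (EuclideanSpace ℝ (Fin 3)) := B.indicator v with hvt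
  have hvtm : AEStronglyMeasurable vt volume :=
    hvc.aestronglyMeasurable.indicator measurableSet_closedBall
  have hsq : (fun y => ‖vt y‖ ^ 2) = B.indicator fun y => ‖v y‖ ^ 2 := by
    funext y
    by_cases hy : y ∈ B
    · simp [hvt, indicator_of_mem hy]
    · simp [hvt, indicator_of_notMem hy]
  have hL2 : Integrable fun y => ‖vt y‖ ^ 2 := by
    rw [hsq, integrable_indicator_iff measurableSet_closedBall]
    exact (hvc.norm.pow 2).continuousOn.integrableOn_compact (isCompact_closedBall _ _)
  obtain ⟨hint, hle⟩ := Literature.Analysis.FluidPDE.integral_abs_mul_norm_le hvtm hL2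
    hgc.aestronglyMeasurable hc hs x₀ hg hg0
  have heq : (fun y => |g y| * ‖vt y‖) = fun y => |g y| * ‖v y‖ := by
    funext y
    by_cases hy : y ∈ B
    · simp [hvt, indicator_of_mem hy]
    · have hy' : ρ < ‖y - x₀‖ := by rwa [hB, mem_closedBall, dist_eq_norm, not_le] at hy
      simp [hg0 y hy']
  rw [heq] at hint hle
  refine ⟨hint, hle.trans_eq ?_⟩
  rw [hsq, integral_indicator measurableSet_closedBall]

/-- **Weighted local energy**: if `|g| ≤ c` and `g` vanishes off `B̄(x₀, ρ)`, then
`∫ |g| |v|² ≤ c ∫_{B̄(x₀,ρ)} |v|²` for continuous `v`, `g`. [folklore] -/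
theorem integral_abs_mul_norm_sq_le_local {v : (EuclideanSpace ℝ (Fin 3)) → (EuclideanSpace ℝ (Fin 3))}
    (hvc : Continuous v) {g : (EuclideanSpace ℝ (Fin 3)) → ℝ} (hgc : Continuous g) {c ρ : ℝ}
    (x₀ : EuclideanSpace ℝ (Fin 3)) (hg : ∀ y, |g y| ≤ c)
    (hg0 : ∀ y, ρ < ‖y - x₀‖ → g y = 0) :
    Integrable (fun y => |g y| * ‖v y‖ ^ 2) ∧
    ∫ y, |g y| * ‖v y‖ ^ 2 ≤ c * ∫ y in closedBall x₀ ρ, ‖v y‖ ^ 2 := by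
  set B := closedBall x₀ ρ with hB
  set Gd : (EuclideanSpace ℝ (Fin 3)) → ℝ := fun y => c * B.indicator (fun y => ‖v y‖ ^ 2) y with hGd
  have hGdi : Integrable Gd := by
    refine Integrable.const_mul ?_ _
    rw [integrable_indicator_iff measurableSet_closedBall]
    exact (hvc.norm.pow 2).continuousOn.integrableOn_compact (isCompact_closedBall _ _)
  have hle : ∀ y, |g y| * ‖v y‖ ^ 2 ≤ Gd y := by
    intro y
    by_cases hy : y ∈ B
    · simp only [hGd, indicator_of_mem hy]
      exact mul_le_mul_of_nonneg_right (hg y) (sq_nonneg _)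
    · have hy' : ρ < ‖y - x₀‖ := by rwa [hB, mem_closedBall, dist_eq_norm, not_le] at hy
      simp only [hGd, indicator_of_notMem hy, hg0 y hy', abs_zero, zero_mul, mul_zero, le_refl]
  have hint : Integrable fun y => |g y| * ‖v y‖ ^ 2 :=
    Integrable.mono' hGdi ((hgc.abs.mul (hvc.norm.pow 2)).aestronglyMeasurable)
      (Eventually.of_forall fun y => by
        rw [Real.norm_eq_abs, abs_mul, abs_abs, abs_of_nonneg (sq_nonneg ‖v y‖)]; exact hle y)
  refine ⟨hint, ?_⟩
  calc ∫ y, |g y| * ‖v y‖ ^ 2 ≤ ∫ y, Gd y :=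
        integral_mono_of_nonneg (Eventually.of_forall fun y => by positivity) hGdi
          (Eventually.of_forall hle)
    _ = c * ∫ y in closedBall x₀ ρ, ‖v y‖ ^ 2 := by
        simp only [hGd]
        rw [integral_const_mul, integral_indicator measurableSet_closedBall]

/-- The volume of `B̄(x₀, 2R)` is `(2R)³ V₁`, `V₁ = vol B̄(0,1)`. [folklore] -/
theorem volume_real_closedBall_two_mul' (x₀ : EuclideanSpace ℝ (Fin 3)) {R : ℝ} (hR : 0 ≤ R) :
    (volume : Measure (EuclideanSpace ℝ (Fin 3))).real (closedBall x₀ (2 * R)) =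
      (2 * R) ^ 3 * (volume : Measure (EuclideanSpace ℝ (Fin 3))).real
        (closedBall (0 : EuclideanSpace ℝ (Fin 3)) 1) := by
  rw [measureReal_def, measureReal_def,
    Measure.addHaar_closedBall volume x₀ (by positivity : (0:ℝ) ≤ 2 * R),
    Measure.addHaar_closedBall volume (0 : EuclideanSpace ℝ (Fin 3)) zero_le_one,
    ENNReal.toReal_mul, ENNReal.toReal_ofReal (by positivity)]
  simp

/-- **Viscous probe term, Morrey class**: `|∫⟪v, Δφ a⟫| ≤ K (1 + A) R⁻¹` for `R ≥ 1`. [folklore] -/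
theorem exists_bound_probe_laplacian_morrey (a x₀ : EuclideanSpace ℝ (Fin 3)) :
    ∃ K, 0 ≤ K ∧ ∀ (v : (EuclideanSpace ℝ (Fin 3)) → (EuclideanSpace ℝ (Fin 3))) (A : ℝ),
    Continuous v →
    (∀ (x : EuclideanSpace ℝ (Fin 3)) (r : ℝ), 1 ≤ r → ∫ y in ball x r, ‖v y‖ ^ 2 ≤ A * r) →
    ∀ (R : ℝ), 1 ≤ R →
      |∫ y, ⟪v y, (Δ (fun y => probeBump R (y - x₀))) y • a⟫| ≤ K * (1 + A) * R⁻¹ := by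
  obtain ⟨⟨C₁, hC₁⟩, ⟨C₂, hC₂⟩⟩ := exists_bound_baseBump_derivs (E := EuclideanSpace ℝ (Fin 3))
  have hC₂0 : 0 ≤ C₂ := (abs_nonneg _).trans (hC₂ 0)
  have hm0 : 0 < baseBumpMass (EuclideanSpace ℝ (Fin 3)) := baseBumpMass_pos
  set V₁ : ℝ := (volume : Measure (EuclideanSpace ℝ (Fin 3))).real
    (closedBall (0 : EuclideanSpace ℝ (Fin 3)) 1) with hV₁
  have hV₁0 : 0 ≤ V₁ := measureReal_nonneg
  refine ⟨‖a‖ * ((baseBumpMass (EuclideanSpace ℝ (Fin 3)))⁻¹ * C₂ * (8 * V₁ + 3)),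
    by positivity, ?_⟩
  intro v A hvc hA R hR1
  have hR : 0 < R := one_pos.trans_le hR1
  have hA0 : 0 ≤ A := morrey_const_nonneg (w := fun y => ‖v y‖ ^ 2) (fun y => sq_nonneg _) hA
  obtain ⟨-, -, -, hΔ, hΔ0⟩ := probeBump_translate_props hR x₀ hC₁ hC₂
  set L := Δ (fun y => probeBump R (y - x₀)) with hL
  have hLc : Continuous L := Literature.Analysis.FluidPDE.continuous_laplacian
    ((contDiff_probeBump (E := EuclideanSpace ℝ (Fin 3)) R (n := 2)).comp
      (contDiff_id.sub contDiff_const))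
  obtain ⟨hIi, hI⟩ := integral_abs_mul_norm_le_local hvc hLc
    (c := (baseBumpMass (EuclideanSpace ℝ (Fin 3)) * R ^ 3)⁻¹ * R⁻¹ ^ 2 * C₂) (s := R⁻¹) (ρ := 2 * R)
    (by positivity) (by positivity) x₀ hΔ hΔ0
  have henergy : ∫ y in closedBall x₀ (2 * R), ‖v y‖ ^ 2 ≤ A * (R * (2 + 1)) := by
    have := integral_closedBall_sq_le_of_morrey hvc hA x₀ hR1 (by norm_num : (0:ℝ) ≤ 2)
    rwa [mul_comm R 2] at this
  have hpt : ∀ y, |⟪v y, L y • a⟫| ≤ ‖a‖ * (|L y| * ‖v y‖) := fun y => by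
    rw [inner_smul_right, abs_mul]
    calc |L y| * |⟪v y, a⟫| ≤ |L y| * (‖v y‖ * ‖a‖) := by
          gcongr; exact abs_real_inner_le_norm _ _
      _ = ‖a‖ * (|L y| * ‖v y‖) := by ring
  have hvol := volume_real_closedBall_two_mul' x₀ hR.le
  calc |∫ y, ⟪v y, L y • a⟫| ≤ ∫ y, ‖a‖ * (|L y| * ‖v y‖) := by
        rw [← Real.norm_eq_abs]
        exact norm_integral_le_of_norm_le (hIi.const_mul ‖a‖) (Eventually.of_forall fun y => by
          rw [Real.norm_eq_abs]; exact hpt y)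
    _ = ‖a‖ * ∫ y, |L y| * ‖v y‖ := integral_const_mul _ _
    _ ≤ ‖a‖ * ((baseBumpMass (EuclideanSpace ℝ (Fin 3)) * R ^ 3)⁻¹ * R⁻¹ ^ 2 * C₂ *
          (R⁻¹ * ((2 * R) ^ 3 * V₁) + R⁻¹⁻¹ * (A * (R * (2 + 1)))) / 2) := by
        refine mul_le_mul_of_nonneg_left (hI.trans ?_) (norm_nonneg _)
        rw [hvol]
        gcongr
    _ = ‖a‖ * ((baseBumpMass (EuclideanSpace ℝ (Fin 3)))⁻¹ * C₂ * (8 * V₁ + 3 * A)) / 2 * R⁻¹ ^ 3 := by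
        field_simp
        ring
    _ ≤ ‖a‖ * ((baseBumpMass (EuclideanSpace ℝ (Fin 3)))⁻¹ * C₂ * (8 * V₁ + 3)) * (1 + A) * R⁻¹ := by
        have hRi : R⁻¹ ≤ 1 := inv_le_one_of_one_le₀ hR1
        have hRi0 : 0 ≤ R⁻¹ := by positivity
        have h3 : R⁻¹ ^ 3 ≤ R⁻¹ := by
          calc R⁻¹ ^ 3 = R⁻¹ * (R⁻¹ * R⁻¹) := by ring
            _ ≤ R⁻¹ * (1 * 1) := mul_le_mul_of_nonneg_left (mul_le_mul hRi hRi hRi0 zero_le_one) hRi0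
            _ = R⁻¹ := by ring
        have h4 : 8 * V₁ + 3 * A ≤ (8 * V₁ + 3) * (1 + A) := by nlinarith
        have h5 : (0:ℝ) ≤ ‖a‖ * ((baseBumpMass (EuclideanSpace ℝ (Fin 3)))⁻¹ * C₂) := by positivity
        calc ‖a‖ * ((baseBumpMass (EuclideanSpace ℝ (Fin 3)))⁻¹ * C₂ * (8 * V₁ + 3 * A)) / 2 * R⁻¹ ^ 3
            ≤ ‖a‖ * ((baseBumpMass (EuclideanSpace ℝ (Fin 3)))⁻¹ * C₂ * (8 * V₁ + 3 * A)) * R⁻¹ := by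
              rw [div_eq_mul_inv]
              have h6 : 0 ≤ ‖a‖ * ((baseBumpMass (EuclideanSpace ℝ (Fin 3)))⁻¹ * C₂ * (8 * V₁ + 3 * A)) := by
                positivity
              nlinarith [mul_nonneg h6 (sub_nonneg.2 h3)]
          _ = ‖a‖ * ((baseBumpMass (EuclideanSpace ℝ (Fin 3)))⁻¹ * C₂) * (8 * V₁ + 3 * A) * R⁻¹ := by ring
          _ ≤ ‖a‖ * ((baseBumpMass (EuclideanSpace ℝ (Fin 3)))⁻¹ * C₂) * ((8 * V₁ + 3) * (1 + A)) * R⁻¹ := by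
              gcongr
          _ = _ := by ring

/-- **Transport probe term, Morrey class**: `|∫⟪v, (v·∇φ) a⟫| ≤ K A R⁻¹`. [folklore] -/
theorem exists_bound_probe_transport_morrey (a x₀ : EuclideanSpace ℝ (Fin 3)) :
    ∃ K, 0 ≤ K ∧ ∀ (v : (EuclideanSpace ℝ (Fin 3)) → (EuclideanSpace ℝ (Fin 3))) (A : ℝ),
    Continuous v →
    (∀ (x : EuclideanSpace ℝ (Fin 3)) (r : ℝ), 1 ≤ r → ∫ y in ball x r, ‖v y‖ ^ 2 ≤ A * r) →
    ∀ (R : ℝ), 1 ≤ R →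
      |∫ y, ⟪v y, fderiv ℝ (fun y => probeBump R (y - x₀)) y (v y) • a⟫| ≤ K * A * R⁻¹ := by
  obtain ⟨⟨C₁, hC₁⟩, ⟨C₂, hC₂⟩⟩ := exists_bound_baseBump_derivs (E := EuclideanSpace ℝ (Fin 3))
  have hC₁0 : 0 ≤ C₁ := (norm_nonneg _).trans (hC₁ 0)
  have hm0 : 0 < baseBumpMass (EuclideanSpace ℝ (Fin 3)) := baseBumpMass_pos
  refine ⟨‖a‖ * ((baseBumpMass (EuclideanSpace ℝ (Fin 3)))⁻¹ * C₁ * 3), by positivity, ?_⟩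
  intro v A hvc hA R hR1
  have hR : 0 < R := one_pos.trans_le hR1
  have hA0 : 0 ≤ A := morrey_const_nonneg (w := fun y => ‖v y‖ ^ 2) (fun y => sq_nonneg _) hA
  obtain ⟨-, hB0, hD, -, -⟩ := probeBump_translate_props hR x₀ hC₁ hC₂
  set c := (baseBumpMass (EuclideanSpace ℝ (Fin 3)) * R ^ 3)⁻¹ * R⁻¹ * C₁ with hc
  have hc0 : 0 ≤ c := by positivity
  have hφ1 : ContDiff ℝ 1 (fun y : EuclideanSpace ℝ (Fin 3) => probeBump R (y - x₀)) :=
    (contDiff_probeBump (E := EuclideanSpace ℝ (Fin 3)) R (n := 1)).comp (contDiff_id.sub contDiff_const)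
  have hgc : Continuous fun y => ‖fderiv ℝ (fun y => probeBump R (y - x₀)) y‖ :=
    (hφ1.continuous_fderiv one_ne_zero).norm
  have hg : ∀ y, |‖fderiv ℝ (fun y => probeBump R (y - x₀)) y‖| ≤ c := fun y => by
    rw [abs_norm]; exact hD y
  have hg0 : ∀ y, 2 * R < ‖y - x₀‖ → ‖fderiv ℝ (fun y => probeBump R (y - x₀)) y‖ = 0 := by
    intro y hy
    rw [norm_eq_zero]
    have hev : (fun y : EuclideanSpace ℝ (Fin 3) => probeBump R (y - x₀)) =ᶠ[𝓝 y] fun _ => 0 := by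
      have ho : IsOpen {w : EuclideanSpace ℝ (Fin 3) | 2 * R < ‖w - x₀‖} :=
        isOpen_lt continuous_const (continuous_id.sub continuous_const).norm
      filter_upwards [ho.mem_nhds hy] with w hw
      exact hB0 w hw
    rw [hev.fderiv_eq]; simp
  obtain ⟨hIi, hI⟩ := integral_abs_mul_norm_sq_le_local hvc hgc x₀ hg hg0
  have henergy : ∫ y in closedBall x₀ (2 * R), ‖v y‖ ^ 2 ≤ A * (R * (2 + 1)) := by
    have := integral_closedBall_sq_le_of_morrey hvc hA x₀ hR1 (by norm_num : (0:ℝ) ≤ 2)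
    rwa [mul_comm R 2] at this
  have hpt : ∀ y, |⟪v y, fderiv ℝ (fun y => probeBump R (y - x₀)) y (v y) • a⟫| ≤
      ‖a‖ * (|‖fderiv ℝ (fun y => probeBump R (y - x₀)) y‖| * ‖v y‖ ^ 2) := fun y => by
    rw [inner_smul_right, abs_mul, abs_norm]
    calc |fderiv ℝ (fun y => probeBump R (y - x₀)) y (v y)| * |⟪v y, a⟫|
        ≤ (‖fderiv ℝ (fun y => probeBump R (y - x₀)) y‖ * ‖v y‖) * (‖v y‖ * ‖a‖) := by
          refine mul_le_mul ?_ (abs_real_inner_le_norm _ _) (abs_nonneg _) (by positivity)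
          rw [← Real.norm_eq_abs]; exact ContinuousLinearMap.le_opNorm _ _
      _ = ‖a‖ * (‖fderiv ℝ (fun y => probeBump R (y - x₀)) y‖ * ‖v y‖ ^ 2) := by ring
  calc |∫ y, ⟪v y, fderiv ℝ (fun y => probeBump R (y - x₀)) y (v y) • a⟫|
      ≤ ∫ y, ‖a‖ * (|‖fderiv ℝ (fun y => probeBump R (y - x₀)) y‖| * ‖v y‖ ^ 2) := by
        rw [← Real.norm_eq_abs]
        exact norm_integral_le_of_norm_le (hIi.const_mul _) (Eventually.of_forall fun y => by
          rw [Real.norm_eq_abs]; exact hpt y)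
    _ = ‖a‖ * ∫ y, |‖fderiv ℝ (fun y => probeBump R (y - x₀)) y‖| * ‖v y‖ ^ 2 := integral_const_mul _ _
    _ ≤ ‖a‖ * (c * (A * (R * (2 + 1)))) :=
        mul_le_mul_of_nonneg_left (hI.trans (mul_le_mul_of_nonneg_left henergy hc0)) (norm_nonneg _)
    _ = ‖a‖ * ((baseBumpMass (EuclideanSpace ℝ (Fin 3)))⁻¹ * C₁ * 3) * A * R⁻¹ ^ 3 := by
        rw [hc]; field_simp; ring
    _ ≤ ‖a‖ * ((baseBumpMass (EuclideanSpace ℝ (Fin 3)))⁻¹ * C₁ * 3) * A * R⁻¹ := by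
        refine mul_le_mul_of_nonneg_left ?_ (by positivity)
        have hRi : R⁻¹ ≤ 1 := inv_le_one_of_one_le₀ hR1
        have hRi0 : 0 ≤ R⁻¹ := by positivity
        calc R⁻¹ ^ 3 = R⁻¹ * (R⁻¹ * R⁻¹) := by ring
          _ ≤ R⁻¹ * (1 * 1) := mul_le_mul_of_nonneg_left (mul_le_mul hRi hRi hRi0 zero_le_one) hRi0
          _ = R⁻¹ := by ring

/-- **Boundary probe term, Morrey class**: `|∫⟪v, φ a⟫| ≤ K (1 + A) R⁻¹`. [folklore] -/
theorem exists_bound_probe_boundary_morrey (a x₀ : EuclideanSpace ℝ (Fin 3)) :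
    ∃ K, 0 ≤ K ∧ ∀ (v : (EuclideanSpace ℝ (Fin 3)) → (EuclideanSpace ℝ (Fin 3))) (A : ℝ),
    Continuous v →
    (∀ (x : EuclideanSpace ℝ (Fin 3)) (r : ℝ), 1 ≤ r → ∫ y in ball x r, ‖v y‖ ^ 2 ≤ A * r) →
    ∀ (R : ℝ), 1 ≤ R →
      |∫ y, ⟪v y, probeBump R (y - x₀) • a⟫| ≤ K * (1 + A) * R⁻¹ := by
  obtain ⟨⟨C₁, hC₁⟩, ⟨C₂, hC₂⟩⟩ := exists_bound_baseBump_derivs (E := EuclideanSpace ℝ (Fin 3))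
  have hm0 : 0 < baseBumpMass (EuclideanSpace ℝ (Fin 3)) := baseBumpMass_pos
  set V₁ : ℝ := (volume : Measure (EuclideanSpace ℝ (Fin 3))).real
    (closedBall (0 : EuclideanSpace ℝ (Fin 3)) 1) with hV₁
  have hV₁0 : 0 ≤ V₁ := measureReal_nonneg
  refine ⟨‖a‖ * ((baseBumpMass (EuclideanSpace ℝ (Fin 3)))⁻¹ * (8 * V₁ + 3)), by positivity, ?_⟩
  intro v A hvc hA R hR1
  have hR : 0 < R := one_pos.trans_le hR1
  have hA0 : 0 ≤ A := morrey_const_nonneg (w := fun y => ‖v y‖ ^ 2) (fun y => sq_nonneg _) hA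
  obtain ⟨hB, hB0, -, -, -⟩ := probeBump_translate_props hR x₀ hC₁ hC₂
  have hφc : Continuous fun y : EuclideanSpace ℝ (Fin 3) => probeBump R (y - x₀) :=
    (contDiff_probeBump (E := EuclideanSpace ℝ (Fin 3)) R (n := 0)).continuous.comp
      (continuous_id.sub continuous_const)
  obtain ⟨hIi, hI⟩ := integral_abs_mul_norm_le_local hvc hφc
    (c := (baseBumpMass (EuclideanSpace ℝ (Fin 3)) * R ^ 3)⁻¹) (s := R⁻¹) (ρ := 2 * R)
    (by positivity) (by positivity) x₀ hB hB0
  have henergy : ∫ y in closedBall x₀ (2 * R), ‖v y‖ ^ 2 ≤ A * (R * (2 + 1)) := by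
    have := integral_closedBall_sq_le_of_morrey hvc hA x₀ hR1 (by norm_num : (0:ℝ) ≤ 2)
    rwa [mul_comm R 2] at this
  have hpt : ∀ y, |⟪v y, probeBump R (y - x₀) • a⟫| ≤ ‖a‖ * (|probeBump R (y - x₀)| * ‖v y‖) :=
    fun y => by
    rw [inner_smul_right, abs_mul]
    calc |probeBump R (y - x₀)| * |⟪v y, a⟫| ≤ |probeBump R (y - x₀)| * (‖v y‖ * ‖a‖) := by
          gcongr; exact abs_real_inner_le_norm _ _
      _ = ‖a‖ * (|probeBump R (y - x₀)| * ‖v y‖) := by ring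
  have hvol := volume_real_closedBall_two_mul' x₀ hR.le
  calc |∫ y, ⟪v y, probeBump R (y - x₀) • a⟫| ≤ ∫ y, ‖a‖ * (|probeBump R (y - x₀)| * ‖v y‖) := by
        rw [← Real.norm_eq_abs]
        exact norm_integral_le_of_norm_le (hIi.const_mul ‖a‖) (Eventually.of_forall fun y => by
          rw [Real.norm_eq_abs]; exact hpt y)
    _ = ‖a‖ * ∫ y, |probeBump R (y - x₀)| * ‖v y‖ := integral_const_mul _ _
    _ ≤ ‖a‖ * ((baseBumpMass (EuclideanSpace ℝ (Fin 3)) * R ^ 3)⁻¹ *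
          (R⁻¹ * ((2 * R) ^ 3 * V₁) + R⁻¹⁻¹ * (A * (R * (2 + 1)))) / 2) := by
        refine mul_le_mul_of_nonneg_left (hI.trans ?_) (norm_nonneg _)
        rw [hvol]
        gcongr
    _ = ‖a‖ * ((baseBumpMass (EuclideanSpace ℝ (Fin 3)))⁻¹ * (8 * V₁ + 3 * A)) / 2 * R⁻¹ := by
        field_simp
        ring
    _ ≤ ‖a‖ * ((baseBumpMass (EuclideanSpace ℝ (Fin 3)))⁻¹ * (8 * V₁ + 3)) * (1 + A) * R⁻¹ := by
        have hRi0 : 0 ≤ R⁻¹ := by positivity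
        have h4 : 8 * V₁ + 3 * A ≤ (8 * V₁ + 3) * (1 + A) := by nlinarith
        have h5 : (0:ℝ) ≤ ‖a‖ * (baseBumpMass (EuclideanSpace ℝ (Fin 3)))⁻¹ := by positivity
        calc ‖a‖ * ((baseBumpMass (EuclideanSpace ℝ (Fin 3)))⁻¹ * (8 * V₁ + 3 * A)) / 2 * R⁻¹
            ≤ ‖a‖ * ((baseBumpMass (EuclideanSpace ℝ (Fin 3)))⁻¹ * (8 * V₁ + 3 * A)) * R⁻¹ := by
              refine mul_le_mul_of_nonneg_right (div_le_self (by positivity) (by norm_num)) hRi0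
          _ = ‖a‖ * (baseBumpMass (EuclideanSpace ℝ (Fin 3)))⁻¹ * (8 * V₁ + 3 * A) * R⁻¹ := by ring
          _ ≤ ‖a‖ * (baseBumpMass (EuclideanSpace ℝ (Fin 3)))⁻¹ * ((8 * V₁ + 3) * (1 + A)) * R⁻¹ := by
              gcongr
          _ = _ := by ring

end Summit.NavierStokesRegularity.NavierStokesRegularity.Theorems.SingularProfile
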